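import Literature.MathematicalPhysics.QuantumFieldTheory.LatticeGaugeStringTensionProofs
import Literature.MathematicalPhysics.QuantumFieldTheory.ConstructiveQFTWave0WilsonLoopRPProofs
import Literature.MathematicalPhysics.QuantumFieldTheory.Balaban1983to89.MatrixNorms
import HarnessLib

/-!
# Thin Wilson rectangles have PERIMETER-size defect: `1 − ⟨W_{n×m}⟩ ≤ (4n − 3)·(1 − ⟨W_{1×m}⟩)` from reflection positivity

Cell `ym3-torus` (HUMAN RULING D-0037, rung R3), width seat `ym3-torus-px5` gen 10, brick (THIN-RECT) for the LINE 28
«GrossTransfer» repair of `stub_linTest` (items 23083 / 19936): the boundary leakage of the lin-proxy identification pairs an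
`ℓ¹`-small current with the axial-gauge bond variables = holonomies of THIN `n × 1` ladders, whose second moment
`E‖U(ladder) − 1‖²` must be of PERIMETER size `≍ n·⟨1 − W_{1×1}⟩`, not the crude `n²·⟨1 − W_{1×1}⟩`.  On the host carrier
(`wilsonMeasure ρ β` on `GaugeConfig d L G`, compact `G`, continuous unitary `ρ`, `β ≥ 0`) this follows from:

* §1 (real sequences) `one_sub_le_of_logConvex`: if `0 ≤ a_k ≤ 1` and `a_{k+1}² ≤ a_k a_{k+2}` (`k ≥ 1`), then the ratios
  `a_{k+1}/a_k` are non-decreasing, so `a_n ≥ a_1 (a_2/a_1)^{n-1}` and, by Bernoulli,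
  `1 − a_n ≤ (1 − a_1) + (n − 1)(1 − a_2)` — LINEAR in `n`;
* §2 (matrices) `one_sub_nReTr_mul_le`: `1 − Re tr(AB) ≤ 2[(1 − Re tr A) + (1 − Re tr B)]` for unitaries (normalised trace;
  `‖U − 1‖²_{HS} = 2(1 − Re tr U)`, [Balaban1987RG1] (0.14), and `AB − 1 = A(B − 1) + (A − 1)`);
* §3 (lattice Stokes) `rectangleHolonomy_add`: the `(R₁+R₂) × T` rectangle is the `R₁ × T` rectangle times a conjugate of the
  adjacent `R₂ × T` rectangle, whence pointwise `1 − W_{(R₁+R₂)×T} ≤ 2[(1 − W_{R₁×T}) + (1 − W_{R₂×T}(shifted))]` and, by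
  translation invariance (`wilsonExpectation_wilsonLoop_eq_zero_base`), `1 − ⟨W_{2×m}⟩ ≤ 4(1 − ⟨W_{1×m}⟩)`;
* §4 the tree's reflection-positivity log-convexity `StringTension.wilsonExpectation_wilsonLoop_sq_le`
  (`⟨W_{(n+1)×m}⟩² ≤ ⟨W_{n×m}⟩⟨W_{(n+2)×m}⟩`, Seiler LNP 159 §2) and positivity `…_nonneg` feed §1:
  **`one_sub_wilsonExpectation_thin_le`**: `1 − ⟨W_{n×m}⟩_β ≤ (4n − 3)(1 − ⟨W_{1×m}⟩_β)` whenever `2n + 4 ≤ L`;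
* §5 the same as a Hilbert–Schmidt / operator-norm second moment: `∫ ‖ρ(U_{n×m}) − 1‖²_{HS} dμ_β ≤ 2(4n−3)(1 − ⟨W_{1×m}⟩)` and
  `∫ |ρ(U_{n×m}) − 1|² dμ_β ≤ 2N(4n−3)(1 − ⟨W_{1×m}⟩)`.

Not here (named for the knitter): the identification «axial-gauge bond = conjugated thin ladder» on Bałaban's unit
lattice and the volume-uniform mean plaquette bound `⟨1 − W_{1×1}⟩_β ≲ log β / β`; the transport to
`T4GenFunBounds.gibbsMeasure` is `GibbsMeasureWilsonDictionary.integral_gibbsMeasure_eq_integral_wilsonMeasure`.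
Everything here is proved; no definitions.
-/

open MeasureTheory
open scoped Matrix.Norms.L2Operator

namespace Summit.QuantumFields.YangMills.Theorems.UnitScaleGibbsThinRectanglePerimeter

open Literature.MathematicalPhysics.QuantumFieldTheory
open Literature.MathematicalPhysics.QuantumFieldTheory.Balaban1983to89.UnitaryModel
open Literature.MathematicalPhysics.QuantumFieldTheory.Balaban1983to89.MatrixNorms

noncomputable section

/-! ## §1 Real sequences: log-convexity on `[0,1]` gives a LINEAR defect bound -/

/-- Ratio monotonicity of a non-negative log-convex sequence: if `r·a₁ ≤ a₂` then `r·a_k ≤ a_{k+1}` for all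
`1 ≤ k < n`. [folklore] -/
theorem ratio_step_of_logConvex (a : ℕ → ℝ) (r : ℝ) {n : ℕ}
    (h0 : ∀ k, 1 ≤ k → k ≤ n → 0 ≤ a k)
    (hlc : ∀ k, 1 ≤ k → k + 2 ≤ n → a (k + 1) ^ 2 ≤ a k * a (k + 2))
    (h12 : r * a 1 ≤ a 2) :
    ∀ k, 1 ≤ k → k + 1 ≤ n → r * a k ≤ a (k + 1) := by
  intro k hk
  induction k, hk using Nat.le_induction with
  | base => intro _; simpa using h12
  | succ k hk ih =>
    intro hkn
    have hih := ih (by omega)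
    have hl := hlc k hk (by omega)
    rcases (h0 k hk (by omega)).eq_or_lt with hk0 | hkpos
    · have h2 : a (k + 1) ^ 2 ≤ 0 := by rw [← hk0, zero_mul] at hl; exact hl
      have h3 : a (k + 1) = 0 := pow_eq_zero_iff (two_ne_zero) |>.mp (le_antisymm h2 (sq_nonneg _))
      rw [h3, mul_zero]
      exact h0 (k + 2) (by omega) (by omega)
    · have h3 : r * a (k + 1) * a k ≤ a (k + 2) * a k :=
        calc r * a (k + 1) * a k = (r * a k) * a (k + 1) := by ring
          _ ≤ a (k + 1) * a (k + 1) := mul_le_mul_of_nonneg_right hih (h0 (k + 1) (by omega) (by omega))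
          _ = a (k + 1) ^ 2 := by ring
          _ ≤ a k * a (k + 2) := hl
          _ = a (k + 2) * a k := by ring
      exact le_of_mul_le_mul_right h3 hkpos

/-- Geometric lower bound for a non-negative log-convex sequence: `a₁ r^{k−1} ≤ a_k` (`1 ≤ k ≤ n`) when `0 ≤ r`,
`r·a₁ ≤ a₂`. [folklore] -/
theorem geom_lower_of_logConvex (a : ℕ → ℝ) (r : ℝ) {n : ℕ}
    (h0 : ∀ k, 1 ≤ k → k ≤ n → 0 ≤ a k)
    (hlc : ∀ k, 1 ≤ k → k + 2 ≤ n → a (k + 1) ^ 2 ≤ a k * a (k + 2))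
    (hr : 0 ≤ r) (h12 : r * a 1 ≤ a 2) :
    ∀ k, 1 ≤ k → k ≤ n → a 1 * r ^ (k - 1) ≤ a k := by
  intro k hk
  induction k, hk using Nat.le_induction with
  | base => intro _; simp
  | succ k hk ih =>
    intro hkn
    have h := ratio_step_of_logConvex a r h0 hlc h12 k hk hkn
    calc a 1 * r ^ (k + 1 - 1) = r * (a 1 * r ^ (k - 1)) := by
          rw [show k + 1 - 1 = (k - 1) + 1 by omega, pow_succ]; ring
      _ ≤ r * a k := mul_le_mul_of_nonneg_left (ih (by omega)) hr
      _ ≤ a (k + 1) := h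

/-- **Linear defect bound for log-convex sequences in `[0,1]`**: if `0 ≤ a_k` (`1 ≤ k ≤ n`), `a₁, a₂ ≤ 1` and
`a_{k+1}² ≤ a_k a_{k+2}` (`1 ≤ k`, `k + 2 ≤ n`), then `1 − a_n ≤ (1 − a₁) + (n − 1)(1 − a₂)`
(ratios non-decreasing ⇒ `a_n ≥ a₁(a₂/a₁)^{n−1}` ⇒ Bernoulli). [folklore] -/
theorem one_sub_le_of_logConvex (a : ℕ → ℝ) {n : ℕ} (hn : 1 ≤ n)
    (h0 : ∀ k, 1 ≤ k → k ≤ n → 0 ≤ a k) (h1 : a 1 ≤ 1) (h2 : a 2 ≤ 1)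
    (hlc : ∀ k, 1 ≤ k → k + 2 ≤ n → a (k + 1) ^ 2 ≤ a k * a (k + 2)) :
    1 - a n ≤ (1 - a 1) + (n - 1 : ℝ) * (1 - a 2) := by
  rcases eq_or_lt_of_le hn with h1n | h1n
  · subst h1n; simp
  have hn1' : (0 : ℝ) ≤ (n : ℝ) - 1 := by
    have : (1 : ℝ) ≤ n := by exact_mod_cast hn
    linarith
  rcases (h0 1 le_rfl hn).eq_or_lt with ha1 | ha1
  · have han : 0 ≤ a n := h0 n hn le_rfl
    have : 0 ≤ ((n : ℝ) - 1) * (1 - a 2) := mul_nonneg hn1' (by linarith)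
    rw [← ha1]
    linarith
  · set r := a 2 / a 1 with hr
    have hr0 : 0 ≤ r := div_nonneg (h0 2 (by norm_num) (by omega)) ha1.le
    have h5 : r * a 1 = a 2 := by rw [hr, div_mul_cancel₀ _ ha1.ne']
    have hgeom := geom_lower_of_logConvex a r h0 hlc hr0 h5.le n hn le_rfl
    have hB : 1 + ((n - 1 : ℕ) : ℝ) * (r - 1) ≤ (1 + (r - 1)) ^ (n - 1) :=
      one_add_mul_le_pow (by linarith) (n - 1)
    rw [add_sub_cancel, Nat.cast_sub hn, Nat.cast_one] at hB
    have h4 : a 1 * (1 + ((n : ℝ) - 1) * (r - 1)) ≤ a n :=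
      (mul_le_mul_of_nonneg_left hB ha1.le).trans hgeom
    have h6 : a 1 * (1 + ((n : ℝ) - 1) * (r - 1)) = a 1 + ((n : ℝ) - 1) * (a 2 - a 1) := by
      rw [← h5]; ring
    rw [h6] at h4
    have h7 : ((n : ℝ) - 1) * (a 1 - a 2) ≤ ((n : ℝ) - 1) * (1 - a 2) :=
      mul_le_mul_of_nonneg_left (by linarith) hn1'
    linarith

/-! ## §2 Matrices: `1 − Re tr(AB) ≤ 2[(1 − Re tr A) + (1 − Re tr B)]` for unitaries -/

section Matrices

variable {ι : Type*} [Fintype ι]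

/-- Parallelogram bound for the normalised Hilbert–Schmidt norm: `‖X + Y‖² ≤ 2‖X‖² + 2‖Y‖²`. [folklore] -/
theorem nhsNormSq_add_le (X Y : Matrix ι ι ℂ) : nhsNormSq (X + Y) ≤ 2 * nhsNormSq X + 2 * nhsNormSq Y := by
  unfold nhsNormSq
  rw [← mul_div_assoc, ← mul_div_assoc, ← add_div]
  refine div_le_div_of_nonneg_right ?_ (Nat.cast_nonneg _)
  rw [Finset.mul_sum, Finset.mul_sum, ← Finset.sum_add_distrib]
  refine Finset.sum_le_sum fun i _ => ?_
  rw [Finset.mul_sum, Finset.mul_sum, ← Finset.sum_add_distrib]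
  refine Finset.sum_le_sum fun j _ => ?_
  rw [Matrix.add_apply]
  have h := norm_add_le (X i j) (Y i j)
  nlinarith [h, norm_nonneg (X i j + Y i j), norm_nonneg (X i j), norm_nonneg (Y i j),
    sq_nonneg (‖X i j‖ - ‖Y i j‖)]

/-- Left multiplication by a unitary does not increase the Hilbert–Schmidt norm: `‖AX‖² ≤ ‖X‖²` (`|A| = 1`). [folklore] -/
theorem nhsNormSq_unitary_mul_le [DecidableEq ι] [Nonempty ι] {A : Matrix ι ι ℂ} (hA : A ∈ Matrix.unitaryGroup ι ℂ)
    (X : Matrix ι ι ℂ) : nhsNormSq (A * X) ≤ nhsNormSq X := by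
  have h := nhsNormSq_mul_le A X
  rwa [norm_of_mem_unitaryGroup hA, one_pow, one_mul] at h

/-- **Two-piece bound**: for unitary `A, B`, `1 − Re tr(AB) ≤ 2[(1 − Re tr A) + (1 − Re tr B)]` (normalised trace):
`‖AB − 1‖² = 2(1 − Re tr AB)` ([Balaban1987RG1] (0.14)), `AB − 1 = A(B − 1) + (A − 1)`, parallelogram bound and `|A| = 1`.
[cite: Balaban1987RG1, (0.14) p.254] -/
theorem one_sub_nReTr_mul_le [DecidableEq ι] [Nonempty ι] {A B : Matrix ι ι ℂ} (hA : A ∈ Matrix.unitaryGroup ι ℂ)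
    (hB : B ∈ Matrix.unitaryGroup ι ℂ) :
    1 - nReTr (A * B) ≤ 2 * ((1 - nReTr A) + (1 - nReTr B)) := by
  have hAB : A * B ∈ Matrix.unitaryGroup ι ℂ := mul_mem hA hB
  have e1 := nhsNormSq_sub_one_of_mem_unitaryGroup hAB
  have eA := nhsNormSq_sub_one_of_mem_unitaryGroup hA
  have eB := nhsNormSq_sub_one_of_mem_unitaryGroup hB
  have hsplit : A * (B - 1) + (A - 1) = A * B - 1 := by rw [mul_sub, mul_one]; abel
  have h := nhsNormSq_add_le (A * (B - 1)) (A - 1)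
  rw [hsplit, e1, eA] at h
  have h2 := nhsNormSq_unitary_mul_le hA (B - 1)
  rw [eB] at h2
  linarith

end Matrices

/-! ## §3 Lattice Stokes: splitting a rectangle along its length -/

section Lattice

variable {d L : ℕ} {G : Type*} [Group G]

/-- **Splitting a rectangle**: the `(R₁+R₂) × T` rectangle holonomy at `x` is the conjugate (by the first `R₁` steps of its
base) of the adjacent `R₂ × T` rectangle at `x + R₁eᵢ`, times the `R₁ × T` rectangle at `x` (the shared rung cancels).
[folklore] -/
theorem rectangleHolonomy_add (U : GaugeConfig d L G) (x : Site d L) (i j : Fin d) (R₁ R₂ T : ℕ) :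
    rectangleHolonomy U x i j (R₁ + R₂) T =
      lineHolonomy U i R₁ x * rectangleHolonomy U (x + Pi.single i (R₁ : ZMod L)) i j R₂ T *
        (lineHolonomy U i R₁ x)⁻¹ * rectangleHolonomy U x i j R₁ T := by
  have h1 : x + Pi.single i ((R₁ + R₂ : ℕ) : ZMod L) =
      x + Pi.single i (R₁ : ZMod L) + Pi.single i (R₂ : ZMod L) := by
    rw [Nat.cast_add, Pi.single_add, add_assoc]
  have h2 : x + Pi.single j (T : ZMod L) + Pi.single i (R₁ : ZMod L) =
      x + Pi.single i (R₁ : ZMod L) + Pi.single j (T : ZMod L) := add_right_comm _ _ _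
  unfold rectangleHolonomy
  rw [WilsonLoopRP.lineHolonomy_add U i R₁ R₂ x, WilsonLoopRP.lineHolonomy_add U i R₁ R₂, h1, h2]
  group

variable {N : ℕ} (ρ : G →* Matrix (Fin N) (Fin N) ℂ)

/-- The Wilson loop observable is the normalised real trace of the represented rectangle holonomy:
`W = Re tr ρ(U_{R×T})` (`UnitaryModel.nReTr`). [folklore] -/
theorem wilsonLoop_eq_nReTr (x : Site d L) (i j : Fin d) (R T : ℕ) (U : GaugeConfig d L G) :
    wilsonLoop ρ x i j R T U = nReTr (ρ (rectangleHolonomy U x i j R T)) := by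
  rw [wilsonLoop, nReTr, Fintype.card_fin, div_eq_inv_mul]

/-- `|W| ≤ 1` pointwise for a unitary representation. [folklore] -/
theorem abs_wilsonLoop_le_one (hρu : ∀ g, ρ g ∈ Matrix.unitaryGroup (Fin N) ℂ) (x : Site d L) (i j : Fin d)
    (R T : ℕ) (U : GaugeConfig d L G) : |wilsonLoop ρ x i j R T U| ≤ 1 := by
  rw [wilsonLoop_eq_nReTr]
  exact abs_nReTr_le_one (hρu _)

/-- For a unitary representation the Hilbert–Schmidt defect of a rectangle holonomy IS the Wilson loop defect:
`‖ρ(U_{R×T}) − 1‖²_{HS} = 2(1 − W_{R×T})`. [cite: Balaban1987RG1, (0.14) p.254] -/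
theorem nhsNormSq_rect_sub_one_eq [NeZero N] (hρu : ∀ g, ρ g ∈ Matrix.unitaryGroup (Fin N) ℂ)
    (x : Site d L) (i j : Fin d) (R T : ℕ) (U : GaugeConfig d L G) :
    nhsNormSq (ρ (rectangleHolonomy U x i j R T) - 1) = 2 * (1 - wilsonLoop ρ x i j R T U) := by
  rw [nhsNormSq_sub_one_of_mem_unitaryGroup (hρu _), wilsonLoop_eq_nReTr]

/-- **Pointwise two-piece bound**: `1 − W_{(R₁+R₂)×T}(x) ≤ 2[(1 − W_{R₂×T}(x + R₁eᵢ)) + (1 − W_{R₁×T}(x))]` for every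
configuration (splitting `rectangleHolonomy_add`, conjugation invariance of the trace, `one_sub_nReTr_mul_le`). [folklore] -/
theorem one_sub_wilsonLoop_add_le [NeZero N] (hρu : ∀ g, ρ g ∈ Matrix.unitaryGroup (Fin N) ℂ)
    (U : GaugeConfig d L G) (x : Site d L) (i j : Fin d) (R₁ R₂ T : ℕ) :
    1 - wilsonLoop ρ x i j (R₁ + R₂) T U ≤
      2 * ((1 - wilsonLoop ρ (x + Pi.single i (R₁ : ZMod L)) i j R₂ T U) + (1 - wilsonLoop ρ x i j R₁ T U)) := by
  simp only [wilsonLoop_eq_nReTr]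
  rw [rectangleHolonomy_add, map_mul, map_mul, map_mul]
  have hA : ρ (lineHolonomy U i R₁ x) * ρ (rectangleHolonomy U (x + Pi.single i (R₁ : ZMod L)) i j R₂ T) *
      ρ (lineHolonomy U i R₁ x)⁻¹ ∈ Matrix.unitaryGroup (Fin N) ℂ :=
    mul_mem (mul_mem (hρu _) (hρu _)) (hρu _)
  have hconj : nReTr (ρ (lineHolonomy U i R₁ x) *
      ρ (rectangleHolonomy U (x + Pi.single i (R₁ : ZMod L)) i j R₂ T) * ρ (lineHolonomy U i R₁ x)⁻¹) =
      nReTr (ρ (rectangleHolonomy U (x + Pi.single i (R₁ : ZMod L)) i j R₂ T)) :=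
    nReTr_conj (by rw [← map_mul, inv_mul_cancel, map_one])
  have h := one_sub_nReTr_mul_le hA (hρu (rectangleHolonomy U x i j R₁ T))
  rw [hconj] at h
  exact h

variable [TopologicalSpace G] [IsTopologicalGroup G] [CompactSpace G] [MeasurableSpace G] [BorelSpace G]

/-- The Wilson loop observable is integrable for the torus Wilson measure (bounded and measurable). [folklore] -/
theorem integrable_wilsonLoop [NeZero L] (hρ : Continuous ρ) (hρu : ∀ g, ρ g ∈ Matrix.unitaryGroup (Fin N) ℂ)
    (β : ℝ) (x : Site d L) (i j : Fin d) (R T : ℕ) :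
    Integrable (wilsonLoop ρ x i j R T) (wilsonMeasure ρ β) := by
  haveI := isProbabilityMeasure_wilsonMeasure (d := d) (L := L) ρ hρ β
  exact (integrable_const (1 : ℝ)).mono' (StringTension.measurable_wilsonLoop ρ hρ x i j R T).aestronglyMeasurable
    (ae_of_all _ fun U => by rw [Real.norm_eq_abs]; exact abs_wilsonLoop_le_one ρ hρu x i j R T U)

/-- `⟨W⟩ ≤ 1`. [folklore] -/
theorem wilsonExpectation_wilsonLoop_le_one [NeZero L] (hρ : Continuous ρ)
    (hρu : ∀ g, ρ g ∈ Matrix.unitaryGroup (Fin N) ℂ) (β : ℝ) (x : Site d L) (i j : Fin d) (R T : ℕ) :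
    wilsonExpectation ρ β (wilsonLoop ρ x i j R T) ≤ 1 := by
  haveI := isProbabilityMeasure_wilsonMeasure (d := d) (L := L) ρ hρ β
  have h := norm_integral_le_of_norm_le_const (μ := wilsonMeasure ρ β) (f := wilsonLoop ρ x i j R T) (C := 1)
    (ae_of_all _ fun U => by rw [Real.norm_eq_abs]; exact abs_wilsonLoop_le_one ρ hρu x i j R T U)
  have h' : |wilsonExpectation ρ β (wilsonLoop ρ x i j R T)| ≤ 1 := by simpa [wilsonExpectation] using h
  exact (abs_le.mp h').2

/-- `1 − ⟨W⟩ = ⟨1 − W⟩` (probability measure, `W` integrable). [folklore] -/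
theorem one_sub_wilsonExpectation_eq [NeZero L] (hρ : Continuous ρ)
    (hρu : ∀ g, ρ g ∈ Matrix.unitaryGroup (Fin N) ℂ) (β : ℝ) (x : Site d L) (i j : Fin d) (R T : ℕ) :
    1 - wilsonExpectation ρ β (wilsonLoop ρ x i j R T) = ∫ U, (1 - wilsonLoop ρ x i j R T U) ∂(wilsonMeasure ρ β) := by
  haveI := isProbabilityMeasure_wilsonMeasure (d := d) (L := L) ρ hρ β
  rw [integral_sub (integrable_const _) (integrable_wilsonLoop ρ hρ hρu β x i j R T), integral_const]
  simp [wilsonExpectation]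

/-- **Two-piece bound in the mean**: `1 − ⟨W_{(R₁+R₂)×T}⟩ ≤ 2[(1 − ⟨W_{R₂×T}⟩) + (1 − ⟨W_{R₁×T}⟩)]` (pointwise bound
integrated; the shifted rectangle has the same mean by translation invariance `wilsonExpectation_wilsonLoop_eq_zero_base`).
[folklore] -/
theorem one_sub_wilsonExpectation_add_le [NeZero L] [NeZero N] (hρ : Continuous ρ)
    (hρu : ∀ g, ρ g ∈ Matrix.unitaryGroup (Fin N) ℂ) (β : ℝ) (i j : Fin d) (R₁ R₂ T : ℕ) :
    1 - wilsonExpectation ρ β (wilsonLoop ρ (0 : Site d L) i j (R₁ + R₂) T) ≤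
      2 * ((1 - wilsonExpectation ρ β (wilsonLoop ρ (0 : Site d L) i j R₂ T)) +
        (1 - wilsonExpectation ρ β (wilsonLoop ρ (0 : Site d L) i j R₁ T))) := by
  haveI := isProbabilityMeasure_wilsonMeasure (d := d) (L := L) ρ hρ β
  have hi : ∀ (y : Site d L) (R : ℕ),
      Integrable (fun U : GaugeConfig d L G => 1 - wilsonLoop ρ y i j R T U) (wilsonMeasure ρ β) :=
    fun y R => (integrable_const (1 : ℝ)).sub (integrable_wilsonLoop ρ hρ hρu β y i j R T)
  have hptw : ∀ U : GaugeConfig d L G, 1 - wilsonLoop ρ (0 : Site d L) i j (R₁ + R₂) T U ≤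
      2 * ((1 - wilsonLoop ρ ((0 : Site d L) + Pi.single i (R₁ : ZMod L)) i j R₂ T U) +
        (1 - wilsonLoop ρ (0 : Site d L) i j R₁ T U)) :=
    fun U => one_sub_wilsonLoop_add_le ρ hρu U (0 : Site d L) i j R₁ R₂ T
  have hint2 : Integrable (fun U : GaugeConfig d L G =>
      2 * ((1 - wilsonLoop ρ ((0 : Site d L) + Pi.single i (R₁ : ZMod L)) i j R₂ T U) +
        (1 - wilsonLoop ρ (0 : Site d L) i j R₁ T U))) (wilsonMeasure ρ β) :=
    ((hi _ R₂).add (hi _ R₁)).const_mul 2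
  have hmono := integral_mono_ae (hi _ _) hint2 (ae_of_all _ hptw)
  have hsplit : ∫ U, 2 * ((1 - wilsonLoop ρ ((0 : Site d L) + Pi.single i (R₁ : ZMod L)) i j R₂ T U) +
        (1 - wilsonLoop ρ (0 : Site d L) i j R₁ T U)) ∂(wilsonMeasure ρ β) =
      2 * ((∫ U, (1 - wilsonLoop ρ ((0 : Site d L) + Pi.single i (R₁ : ZMod L)) i j R₂ T U) ∂(wilsonMeasure ρ β)) +
        ∫ U, (1 - wilsonLoop ρ (0 : Site d L) i j R₁ T U) ∂(wilsonMeasure ρ β)) := by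
    rw [integral_const_mul, integral_add (hi _ R₂) (hi _ R₁)]
  rw [one_sub_wilsonExpectation_eq ρ hρ hρu β (0 : Site d L) i j (R₁ + R₂) T,
    one_sub_wilsonExpectation_eq ρ hρ hρu β (0 : Site d L) i j R₁ T,
    ← wilsonExpectation_wilsonLoop_eq_zero_base ρ β ((0 : Site d L) + Pi.single i (R₁ : ZMod L)) i j R₂ T,
    one_sub_wilsonExpectation_eq ρ hρ hρu β _ i j R₂ T]
  linarith [hmono, hsplit]

/-- `1 − ⟨W_{2×T}⟩ ≤ 4(1 − ⟨W_{1×T}⟩)`. [folklore] -/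
theorem one_sub_wilsonExpectation_two_le [NeZero L] [NeZero N] (hρ : Continuous ρ)
    (hρu : ∀ g, ρ g ∈ Matrix.unitaryGroup (Fin N) ℂ) (β : ℝ) (i j : Fin d) (T : ℕ) :
    1 - wilsonExpectation ρ β (wilsonLoop ρ (0 : Site d L) i j 2 T) ≤
      4 * (1 - wilsonExpectation ρ β (wilsonLoop ρ (0 : Site d L) i j 1 T)) := by
  have h := one_sub_wilsonExpectation_add_le (L := L) ρ hρ hρu β i j 1 1 T
  rw [show (1 : ℕ) + 1 = 2 from rfl] at h
  linarith

/-! ## §4 Reflection positivity: thin rectangles have perimeter-size defect -/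

variable [NeZero d] [NeZero L] [Fact (1 < L)]

/-- From log-convexity (`StringTension.wilsonExpectation_wilsonLoop_sq_le`) and positivity of the loop expectations:
`1 − ⟨W_{n×m}⟩ ≤ (1 − ⟨W_{1×m}⟩) + (n − 1)(1 − ⟨W_{2×m}⟩)` for `β ≥ 0`, `j ≠ 0`, `1 ≤ n`, `2n + 4 ≤ L`.
[cite: SeilerLNP1982, §2 (static quark potential and string tension from reflection positivity)] -/
theorem one_sub_wilsonExpectation_le_of_first_two [NeZero N] (hρ : Continuous ρ)
    (hρu : ∀ g, ρ g ∈ Matrix.unitaryGroup (Fin N) ℂ) {β : ℝ} (hβ : 0 ≤ β) {j : Fin d} (hj : j ≠ 0) {n : ℕ}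
    (hn1 : 1 ≤ n) (hn : 2 * n + 4 ≤ L) (m : ℕ) :
    1 - wilsonExpectation ρ β (wilsonLoop ρ (0 : Site d L) 0 j n m) ≤
      (1 - wilsonExpectation ρ β (wilsonLoop ρ (0 : Site d L) 0 j 1 m)) +
        (n - 1 : ℝ) * (1 - wilsonExpectation ρ β (wilsonLoop ρ (0 : Site d L) 0 j 2 m)) :=
  one_sub_le_of_logConvex (fun k => wilsonExpectation ρ β (wilsonLoop ρ (0 : Site d L) 0 j k m)) hn1
    (fun k hk hkn => StringTension.wilsonExpectation_wilsonLoop_nonneg ρ hρ hβ hj hk (by omega) m)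
    (wilsonExpectation_wilsonLoop_le_one ρ hρ hρu β _ _ _ _ _)
    (wilsonExpectation_wilsonLoop_le_one ρ hρ hρu β _ _ _ _ _)
    (fun k hk hkn => StringTension.wilsonExpectation_wilsonLoop_sq_le ρ hρ hβ hj hk (by omega) m)

/-- **(THIN-RECT) Thin rectangles have PERIMETER-size defect**: for the torus Wilson measure of a compact group with a
continuous unitary `N`-dimensional representation, `β ≥ 0`, a spatial direction `j ≠ 0`, `1 ≤ n` and `2n + 4 ≤ L`,
`1 − ⟨W_{n×m}⟩_β ≤ (4n − 3)·(1 − ⟨W_{1×m}⟩_β)` — LINEAR in the length `n` (for `m = 1`: in the mean plaquette defect),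
where the crude bound is quadratic. [cite: SeilerLNP1982, §2 (static quark potential and string tension from reflection positivity)] -/
theorem one_sub_wilsonExpectation_thin_le [NeZero N] (hρ : Continuous ρ)
    (hρu : ∀ g, ρ g ∈ Matrix.unitaryGroup (Fin N) ℂ) {β : ℝ} (hβ : 0 ≤ β) {j : Fin d} (hj : j ≠ 0) {n : ℕ}
    (hn1 : 1 ≤ n) (hn : 2 * n + 4 ≤ L) (m : ℕ) :
    1 - wilsonExpectation ρ β (wilsonLoop ρ (0 : Site d L) 0 j n m) ≤
      (4 * n - 3 : ℝ) * (1 - wilsonExpectation ρ β (wilsonLoop ρ (0 : Site d L) 0 j 1 m)) := by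
  have h1 := one_sub_wilsonExpectation_le_of_first_two ρ hρ hρu hβ hj hn1 hn m
  have h2 := one_sub_wilsonExpectation_two_le (L := L) ρ hρ hρu β 0 j m
  have hn' : (0 : ℝ) ≤ (n : ℝ) - 1 := by
    have : (1 : ℝ) ≤ n := by exact_mod_cast hn1
    linarith
  have h3 := mul_le_mul_of_nonneg_left h2 hn'
  calc 1 - wilsonExpectation ρ β (wilsonLoop ρ (0 : Site d L) 0 j n m)
      ≤ (1 - wilsonExpectation ρ β (wilsonLoop ρ (0 : Site d L) 0 j 1 m)) +
        (n - 1 : ℝ) * (1 - wilsonExpectation ρ β (wilsonLoop ρ (0 : Site d L) 0 j 2 m)) := h1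
    _ ≤ (1 - wilsonExpectation ρ β (wilsonLoop ρ (0 : Site d L) 0 j 1 m)) +
        (n - 1 : ℝ) * (4 * (1 - wilsonExpectation ρ β (wilsonLoop ρ (0 : Site d L) 0 j 1 m))) :=
      by linarith [h3]
    _ = (4 * n - 3 : ℝ) * (1 - wilsonExpectation ρ β (wilsonLoop ρ (0 : Site d L) 0 j 1 m)) := by ring

/-- (THIN-RECT) at an arbitrary base point `x` (translation invariance). [cite: SeilerLNP1982, §2 (static quark potential and string tension from reflection positivity)] -/
theorem one_sub_wilsonExpectation_thin_le_base [NeZero N] (hρ : Continuous ρ)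
    (hρu : ∀ g, ρ g ∈ Matrix.unitaryGroup (Fin N) ℂ) {β : ℝ} (hβ : 0 ≤ β) {j : Fin d} (hj : j ≠ 0) {n : ℕ}
    (hn1 : 1 ≤ n) (hn : 2 * n + 4 ≤ L) (m : ℕ) (x : Site d L) :
    1 - wilsonExpectation ρ β (wilsonLoop ρ x 0 j n m) ≤
      (4 * n - 3 : ℝ) * (1 - wilsonExpectation ρ β (wilsonLoop ρ (0 : Site d L) 0 j 1 m)) := by
  rw [wilsonExpectation_wilsonLoop_eq_zero_base ρ β x]
  exact one_sub_wilsonExpectation_thin_le ρ hρ hρu hβ hj hn1 hn m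

/-! ## §5 The same as a second moment of `ρ(U_{n×m}) − 1` -/

/-- **(THIN-RECT), Hilbert–Schmidt form**: `∫ ‖ρ(U_{n×m}(x)) − 1‖²_{HS} dμ_β ≤ 2(4n − 3)(1 − ⟨W_{1×m}⟩_β)`.
[cite: SeilerLNP1982, §2 (static quark potential and string tension from reflection positivity)] -/
theorem integral_nhsNormSq_thinRect_sub_one_le [NeZero N] (hρ : Continuous ρ)
    (hρu : ∀ g, ρ g ∈ Matrix.unitaryGroup (Fin N) ℂ) {β : ℝ} (hβ : 0 ≤ β) {j : Fin d} (hj : j ≠ 0) {n : ℕ}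
    (hn1 : 1 ≤ n) (hn : 2 * n + 4 ≤ L) (m : ℕ) (x : Site d L) :
    ∫ U, nhsNormSq (ρ (rectangleHolonomy U x 0 j n m) - 1) ∂(wilsonMeasure ρ β) ≤
      2 * (4 * n - 3 : ℝ) * (1 - wilsonExpectation ρ β (wilsonLoop ρ (0 : Site d L) 0 j 1 m)) := by
  simp only [nhsNormSq_rect_sub_one_eq ρ hρu]
  rw [integral_const_mul, ← one_sub_wilsonExpectation_eq ρ hρ hρu, mul_assoc]
  exact mul_le_mul_of_nonneg_left (one_sub_wilsonExpectation_thin_le_base ρ hρ hρu hβ hj hn1 hn m x) (by norm_num)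

/-- **(THIN-RECT), operator-norm form**: `∫ |ρ(U_{n×m}(x)) − 1|² dμ_β ≤ 2N(4n − 3)(1 − ⟨W_{1×m}⟩_β)` (`|·|² ≤ N‖·‖²_{HS}`).
[cite: SeilerLNP1982, §2 (static quark potential and string tension from reflection positivity)] -/
theorem integral_opNormSq_thinRect_sub_one_le [NeZero N] (hρ : Continuous ρ)
    (hρu : ∀ g, ρ g ∈ Matrix.unitaryGroup (Fin N) ℂ) {β : ℝ} (hβ : 0 ≤ β) {j : Fin d} (hj : j ≠ 0) {n : ℕ}
    (hn1 : 1 ≤ n) (hn : 2 * n + 4 ≤ L) (m : ℕ) (x : Site d L) :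
    ∫ U, ‖ρ (rectangleHolonomy U x 0 j n m) - 1‖ ^ 2 ∂(wilsonMeasure ρ β) ≤
      2 * N * (4 * n - 3 : ℝ) * (1 - wilsonExpectation ρ β (wilsonLoop ρ (0 : Site d L) 0 j 1 m)) := by
  haveI := isProbabilityMeasure_wilsonMeasure (d := d) (L := L) ρ hρ β
  have hpt : ∀ U : GaugeConfig d L G, ‖ρ (rectangleHolonomy U x 0 j n m) - 1‖ ^ 2 ≤
      (N : ℝ) * (2 * (1 - wilsonLoop ρ x 0 j n m U)) := fun U => by
    have h := opNorm_sq_le_card_mul_nhsNormSq (ρ (rectangleHolonomy U x 0 j n m) - 1)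
    rw [Fintype.card_fin, nhsNormSq_rect_sub_one_eq ρ hρu] at h
    exact h
  have hint : Integrable (fun U : GaugeConfig d L G => (N : ℝ) * (2 * (1 - wilsonLoop ρ x 0 j n m U)))
      (wilsonMeasure ρ β) :=
    (((integrable_const (1 : ℝ)).sub (integrable_wilsonLoop ρ hρ hρu β x 0 j n m)).const_mul _).const_mul _
  calc ∫ U, ‖ρ (rectangleHolonomy U x 0 j n m) - 1‖ ^ 2 ∂(wilsonMeasure ρ β)
      ≤ ∫ U, (N : ℝ) * (2 * (1 - wilsonLoop ρ x 0 j n m U)) ∂(wilsonMeasure ρ β) :=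
        integral_mono_of_nonneg (ae_of_all _ fun U => sq_nonneg _) hint (ae_of_all _ hpt)
    _ = 2 * N * (1 - wilsonExpectation ρ β (wilsonLoop ρ x 0 j n m)) := by
        rw [integral_const_mul, integral_const_mul, ← one_sub_wilsonExpectation_eq ρ hρ hρu]; ring
    _ ≤ 2 * N * ((4 * n - 3 : ℝ) * (1 - wilsonExpectation ρ β (wilsonLoop ρ (0 : Site d L) 0 j 1 m))) :=
        mul_le_mul_of_nonneg_left (one_sub_wilsonExpectation_thin_le_base ρ hρ hρu hβ hj hn1 hn m x) (by positivity)
    _ = 2 * N * (4 * n - 3 : ℝ) * (1 - wilsonExpectation ρ β (wilsonLoop ρ (0 : Site d L) 0 j 1 m)) := by ring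

end Lattice

end

end Summit.QuantumFields.YangMills.Theorems.UnitScaleGibbsThinRectanglePerimeter
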